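import Summits.QuantumFields.YangMills.Theorems.FemtoTransferGapRungW1upAlgebra
import Literature.MathematicalPhysics.QuantumFieldTheory.Balaban1983to89.T4HaarSU2Translate
import HarnessLib

/-!
# The ODD seam sectors of the swap-glued femto ring carry no flat connection: `ab = ba`, `ta = bt`, `tb = −at` is impossible in `SU(2)`
# (free-hands support of item stmt-QuantumFields-24197 `SwapVirialDeficit.SwapGluedStiffness`; the algebraic core of line «ε_aε_b = −1 (4 sectors): NO flat
# points ⇒ min F^S_z > 0, exponentially suppressed» of seat w2 g54's stratum census SWAP-STRATA §2 (evidence #2 on ⟨stmt-QuantumFields-23802⟩))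

The swap-twisted zero-flux trace `Z^S = TT.twistTrace L β (2L)` is `(1/8) Σ_z` over the eight 't Hooft seam sectors `z : Fin 3 → Bool`
(✓`SwapRing.twistTrace_eq_sum_exp_mul_integral_deficit`).  The flat connections of sector `z` are representations in `SU(2)` of
`⟨a, b, c, t | [a,b], [a,c], [b,c], t a t⁻¹ = ε_a b, t b t⁻¹ = ε_b a, t c t⁻¹ = ε_c c⟩`, `ε = ±1` central signs.  When `ε_aε_b = −1` there is NONE:
`t²` then ANTICOMMUTES with `a` (and with `b`), which in the quaternions forces `a`, `b` (and `t²`) to be purely imaginary; two commuting purely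
imaginary quaternions have a REAL product `ab`; but `t(ab) = b·tb = −(ba)t = −(ab)t`, so `ab` anticommutes with `t ≠ 0` and is purely imaginary as
well — hence `ab = 0`, contradicting `a, b ≠ 0`.  Consequently the action deficit `F^S_z` of such a sector has an EMPTY zero set and (by compactness,
not formalised here) a positive minimum at fixed `L`: these four sectors are exponentially suppressed in `Z^S` as `β → ∞`.

* §1 `re_eq_zero_of_anticomm` (`xy = −yx`, `y ≠ 0` ⟹ `re x = 0`), `im_mul_eq_zero_of_comm_of_re` (commuting purely imaginary quaternions have a real product);
* §2 ★ `no_flat_odd_sector` (quaternions: `a ≠ 0`, `t ≠ 0`, `ab = ba`, `ta = bt`, `tb = −(at)` ⟹ `False`), ★ `no_flat_odd_sector_su2` (the same in `SU(2)` with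
  the centre element ✓`negOne`: `A B = B A`, `T A = B T`, `T B = negOne · A · T` ⟹ `False`), `no_flat_odd_sector_su2'` (signs `(−,+)`).

HONEST LABEL: finite-dimensional algebra toward a fixed-`L` prediction row (which seam sectors of `Z^S` are flat-free); the lattice statement
`F^S_z ≥ c_L > 0` for `z 0 ≠ z 1` is NOT proved here (needs the zero-set characterisation of ✓`swapRingDeficit`); ⟨24197⟩, ⟨24194⟩, ⟨24497⟩, ⟨24196⟩ stay
OPEN; the Yang–Mills mass gap is NOT proved; no summit is proved by a line.  THEOREMS ONLY (0 `def`, 0 `sorry`), standard axioms.  Width seat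
ym-line-sfw-p2-w2 g54 (cell ym-idea-1, free hands), `--supports stmt-QuantumFields-24197`.  References: [cite: tHooft1979]; [cite: GonzalezarroyoAltes1988]; [folklore].
-/

set_option autoImplicit false

noncomputable section

open Quaternion
open scoped Quaternion
open Literature.MathematicalPhysics.QuantumLattice
open Summit.QuantumFields.YangMills.Theorems.FemtoTransferGap (SU2 negOne)
open Literature.MathematicalPhysics.QuantumFieldTheory.Balaban1983to89.T4HaarSU2Translate (su2Quat_mul)

namespace Summit.QuantumFields.YangMills.Theorems.SwapVirialDeficit.OddSectorNoFlat

/-! ## §1 Anticommuting and commuting quaternions -/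

/-- **Anticommutation kills the real part**: if `x y = −y x` with `y ≠ 0` then `re x = 0`. [folklore] -/
theorem re_eq_zero_of_anticomm {x y : ℍ} (h : x * y = -(y * x)) (hy : y ≠ 0) : x.re = 0 := by
  have hre := congrArg QuaternionAlgebra.re h
  have hI := congrArg QuaternionAlgebra.imI h
  have hJ := congrArg QuaternionAlgebra.imJ h
  have hK := congrArg QuaternionAlgebra.imK h
  simp only [Quaternion.re_mul, Quaternion.imI_mul, Quaternion.imJ_mul, Quaternion.imK_mul, Quaternion.re_neg, Quaternion.imI_neg,
    Quaternion.imJ_neg, Quaternion.imK_neg] at hre hI hJ hK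
  by_contra hx
  -- `re y · ‖x‖² = 0`
  have h0 : y.re * (x.re ^ 2 + x.imI ^ 2 + x.imJ ^ 2 + x.imK ^ 2) = 0 := by
    linear_combination (1 / 2 : ℝ) * x.re * hre + (1 / 2 : ℝ) * x.imI * hI + (1 / 2 : ℝ) * x.imJ * hJ + (1 / 2 : ℝ) * x.imK * hK
  have hpos : 0 < x.re ^ 2 + x.imI ^ 2 + x.imJ ^ 2 + x.imK ^ 2 := by positivity
  have hy0 : y.re = 0 := by
    rcases mul_eq_zero.1 h0 with h | h
    · exact h
    · exact absurd h hpos.ne'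
  -- then `re x · Im y = 0`, so `Im y = 0`
  have hy1 : y.imI = 0 := by
    have : x.re * y.imI = 0 := by linear_combination (1 / 2 : ℝ) * hI + (-x.imI) * hy0
    rcases mul_eq_zero.1 this with h | h
    · exact absurd h hx
    · exact h
  have hy2 : y.imJ = 0 := by
    have : x.re * y.imJ = 0 := by linear_combination (1 / 2 : ℝ) * hJ + (-x.imJ) * hy0
    rcases mul_eq_zero.1 this with h | h
    · exact absurd h hx
    · exact h
  have hy3 : y.imK = 0 := by
    have : x.re * y.imK = 0 := by linear_combination (1 / 2 : ℝ) * hK + (-x.imK) * hy0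
    rcases mul_eq_zero.1 this with h | h
    · exact absurd h hx
    · exact h
  apply hy
  ext
  · rw [hy0]; rfl
  · rw [hy1]; rfl
  · rw [hy2]; rfl
  · rw [hy3]; rfl

/-- **Commuting purely imaginary quaternions have a real product**: `re a = re b = 0`, `ab = ba` ⟹ `Im(ab) = 0`. [folklore] -/
theorem im_mul_eq_zero_of_comm_of_re {a b : ℍ} (ha : a.re = 0) (hb : b.re = 0) (hab : a * b = b * a) :
    (a * b).imI = 0 ∧ (a * b).imJ = 0 ∧ (a * b).imK = 0 := by
  have hI := congrArg QuaternionAlgebra.imI hab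
  have hJ := congrArg QuaternionAlgebra.imJ hab
  have hK := congrArg QuaternionAlgebra.imK hab
  simp only [Quaternion.imI_mul, Quaternion.imJ_mul, Quaternion.imK_mul] at hI hJ hK
  simp only [Quaternion.imI_mul, Quaternion.imJ_mul, Quaternion.imK_mul, ha, hb, zero_mul, mul_zero, zero_add, add_zero, zero_sub]
  refine ⟨?_, ?_, ?_⟩
  · linear_combination (1 / 2 : ℝ) * hI
  · linear_combination (1 / 2 : ℝ) * hJ
  · linear_combination (1 / 2 : ℝ) * hK

/-! ## §2 No flat connection in the odd seam sectors -/

/-- ★ **NO FLAT CONNECTION IN AN ODD SEAM SECTOR.**  In the quaternions there are no `a ≠ 0`, `t ≠ 0`, `b` with `ab = ba`, `ta = bt` and `tb = −at`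
(the relations `t a t⁻¹ = b`, `t b t⁻¹ = −a` of the sector `(ε_a, ε_b) = (+, −)` of `ℤ³ ⋊_σ ℤ`; the letter `c` plays no role). [folklore] -/
theorem no_flat_odd_sector {a b t : ℍ} (ha : a ≠ 0) (ht : t ≠ 0) (hab : a * b = b * a) (h1 : t * a = b * t) (h2 : t * b = -(a * t)) :
    False := by
  -- `b ≠ 0`
  have hb : b ≠ 0 := by
    intro hb0
    rw [hb0, zero_mul] at h1
    exact ha ((mul_eq_zero.1 h1).resolve_left ht)
  -- `s = t²` anticommutes with `a` and with `b`
  have hs : t * t ≠ 0 := mul_ne_zero ht ht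
  have hsa : (t * t) * a = -(a * (t * t)) := by
    rw [mul_assoc, h1, ← mul_assoc, h2, neg_mul, mul_assoc]
  have hsb : (t * t) * b = -(b * (t * t)) := by
    rw [mul_assoc, h2, mul_neg, ← mul_assoc, h1, mul_assoc]
  -- hence `a`, `b` are purely imaginary
  have ha0 : a.re = 0 := by
    have h : a * (t * t) = -((t * t) * a) := by rw [hsa, neg_neg]
    exact re_eq_zero_of_anticomm h hs
  have hb0 : b.re = 0 := by
    have h : b * (t * t) = -((t * t) * b) := by rw [hsb, neg_neg]
    exact re_eq_zero_of_anticomm h hs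
  -- `ab` is real …
  obtain ⟨hI, hJ, hK⟩ := im_mul_eq_zero_of_comm_of_re ha0 hb0 hab
  -- … and anticommutes with `t`, hence is purely imaginary
  have htab : t * (a * b) = -((a * b) * t) := by
    calc t * (a * b) = (t * a) * b := (mul_assoc _ _ _).symm
      _ = (b * t) * b := by rw [h1]
      _ = b * (t * b) := mul_assoc _ _ _
      _ = b * (-(a * t)) := by rw [h2]
      _ = -((b * a) * t) := by rw [mul_neg, mul_assoc]
      _ = -((a * b) * t) := by rw [hab]
  have hre : (a * b).re = 0 := by
    have h : (a * b) * t = -(t * (a * b)) := by rw [htab, neg_neg]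
    exact re_eq_zero_of_anticomm h ht
  -- so `ab = 0`: contradiction
  have hab0 : a * b = 0 := by
    ext
    · rw [hre]; rfl
    · rw [hI]; rfl
    · rw [hJ]; rfl
    · rw [hK]; rfl
  rcases mul_eq_zero.1 hab0 with h | h
  · exact ha h
  · exact hb h

/-- `su2Quat (negOne · A) = −su2Quat A`. [folklore] -/
theorem su2Quat_negOne_mul (A : SU2) : su2Quat (negOne * A) = -su2Quat A := by
  ext <;> simp [su2Quat, Matrix.neg_apply]

/-- ★ **No flat connection in the odd seam sector `(+, −)` of the swap-glued ring, `SU(2)` form**: there are no `A B T ∈ SU(2)` with `AB = BA`,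
`TA = BT`, `TB = (−1)·A·T`. [cite: tHooft1979] -/
theorem no_flat_odd_sector_su2 (A B T : SU2) (hAB : A * B = B * A) (h1 : T * A = B * T) (h2 : T * B = negOne * A * T) : False := by
  have hAB' : su2Quat A * su2Quat B = su2Quat B * su2Quat A := by rw [← su2Quat_mul, ← su2Quat_mul, hAB]
  have h1' : su2Quat T * su2Quat A = su2Quat B * su2Quat T := by rw [← su2Quat_mul, ← su2Quat_mul, h1]
  have h2' : su2Quat T * su2Quat B = -(su2Quat A * su2Quat T) := by
    rw [← su2Quat_mul, ← su2Quat_mul, h2, mul_assoc, su2Quat_negOne_mul]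
  exact no_flat_odd_sector (su2Quat_ne_zero A) (su2Quat_ne_zero T) hAB' h1' h2'

/-- **The mirror sector `(−, +)`**: no `A B T ∈ SU(2)` with `AB = BA`, `TA = (−1)·B·T`, `TB = AT`. [cite: tHooft1979] -/
theorem no_flat_odd_sector_su2' (A B T : SU2) (hAB : A * B = B * A) (h1 : T * A = negOne * B * T) (h2 : T * B = A * T) : False :=
  no_flat_odd_sector_su2 B A T hAB.symm h2 h1

end Summit.QuantumFields.YangMills.Theorems.SwapVirialDeficit.OddSectorNoFlat

end
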